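import Summits.Ventures.PercRepro.ThetaSet
import Summits.Ventures.PercRepro.MSTightDefect

/-!
# The one-pair theorem in near-member form, and the merge lemma (M2) of the merge induction

Two tools for the merge induction on Conjecture V (proofs/MINE1-theoremS.md, Addenda 11 and 14).

* `card_add_one_le_of_cells` — **the one-pair regime theorem for a family with a near-member**:
  if `F` has no complementary pair, `u, uᶜ ∉ F`, and `D` contains every difference of `F` and,
  for every member `t`, the two agreement cells `t ∩ u`, `tᶜ ∩ uᶜ` or the two disagreement cells
  `t \ u`, `u \ t` (according to a sign pattern `σ`), then `|D| ≥ |F| + 1`. This is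
  `theta_card_le_of_card_le_one` (ThetaSet.lean) for the instance `(A, {u}, C)` with
  `A = {t ∈ F : σ t}` and `C = {tᶜ : t ∈ F, ¬σ t}`, whose (Θ)-difference family lies in `D`.

* `merge_card_eq`, `merge_diffs_subset`, `merge_cells` — **the merge lemma (M2)**: for a residue
  instance `(F, u)` and two elements `r, r'` on the same side of `u`, write `F'` for the
  non-separating members (`r ∈ t ↔ r' ∈ t`) and `D'` for the non-separating differences; if the
  separating differences are at least as many as the separating members ((SEP) at the pair), then
  `|D'| = |F'| + 1`, `D'` contains every difference of `F'`, and every member of `F'` keeps its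
  cells in `D'` — so `(F', u)` is again an equality instance of the one-pair theorem (it is a
  residue instance whenever some A-only and some C*-only member of `F` do not separate `r, r'`,
  and of the excess kind whenever `F'` is not tight; Addendum 14).
-/

namespace PercRepro.MSTight

open Finset
open scoped FinsetFamily

variable {α : Type*} [DecidableEq α] [Fintype α]

/-- Complementing twice is the identity on families. -/
theorem compls_compls (A : Finset (Finset α)) : compls (compls A) = A := by
  ext t
  rw [mem_compls, mem_compls, Finset.sdiff_sdiff_eq_self (subset_univ t)]

/-- `compls` is monotone. -/
theorem compls_subset_compls {A B : Finset (Finset α)} (h : A ⊆ B) : compls A ⊆ compls B := by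
  intro x hx
  exact mem_compls.2 (h (mem_compls.1 hx))

/-- A family whose members are all empty and which misses `∅` is empty; in particular a
nonempty family with `u ∉ F` has `uᶜ ≠ u`. -/
theorem compl_ne_self_of_nonempty {F : Finset (Finset α)} (hne : F.Nonempty) {u : Finset α}
    (hu : u ∉ F) : Finset.univ \ u ≠ u := by
  intro h
  have hu0 : u = ∅ := by
    have hsub : u ⊆ Finset.univ \ u := by rw [h]
    rw [Finset.eq_empty_iff_forall_notMem]
    intro a ha
    exact (mem_sdiff.1 (hsub ha)).2 ha
  subst hu0
  rw [Finset.sdiff_empty] at h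
  have hemp : IsEmpty α := Finset.univ_eq_empty_iff.1 h
  obtain ⟨t, ht⟩ := hne
  have : t = ∅ := Finset.eq_empty_of_isEmpty t
  subst this
  exact hu ht

/-- **The one-pair theorem, near-member form.** A family without complementary pairs with a
near-member `u ∉ F ∪ Fᶜ` has at least `|F| + 1` sets among its differences and required cells. -/
theorem card_add_one_le_of_cells {F D : Finset (Finset α)} (σ : Finset α → Bool) {u : Finset α}
    (hne : F.Nonempty) (hval : Disjoint F (compls F)) (hu : u ∉ F) (huc : Finset.univ \ u ∉ F)
    (hD : F \\ F ⊆ D)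
    (hcells : ∀ t ∈ F, Cells D t (if σ t = true then u else Finset.univ \ u)) :
    F.card + 1 ≤ D.card := by
  obtain ⟨A, hA⟩ : ∃ A, A = F.filter (fun t => σ t = true) := ⟨_, rfl⟩
  obtain ⟨F₂, hF₂⟩ : ∃ F₂, F₂ = F.filter (fun t => ¬ σ t = true) := ⟨_, rfl⟩
  have hAF : A ⊆ F := by rw [hA]; exact filter_subset _ _
  have hF₂F : F₂ ⊆ F := by rw [hF₂]; exact filter_subset _ _
  have hAσ : ∀ t ∈ A, σ t = true := fun t ht => by rw [hA] at ht; exact (mem_filter.1 ht).2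
  have hF₂σ : ∀ t ∈ F₂, ¬ σ t = true := fun t ht => by rw [hF₂] at ht; exact (mem_filter.1 ht).2
  have hcard : A.card + F₂.card = F.card := by
    rw [hA, hF₂]; exact Finset.card_filter_add_card_filter_not _
  have hcellsA : ∀ t ∈ A, Cells D t u := fun t ht => by
    have := hcells t (hAF ht); rwa [if_pos (hAσ t ht)] at this
  have hcellsC : ∀ t ∈ F₂, Cells D t (Finset.univ \ u) := fun t ht => by
    have := hcells t (hF₂F ht); rwa [if_neg (hF₂σ t ht)] at this
  have hvalF : ∀ t ∈ F, Finset.univ \ t ∉ F := fun t ht h =>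
    Finset.disjoint_left.1 hval ht (mem_compls.2 h)
  -- validity of the instance `(A, {u}, compls F₂)`
  have hvalid : ThetaValid A {u} (compls F₂) := by
    refine ⟨?_, ?_, ?_, ?_, ?_, ?_, ?_, ?_, ?_⟩
    · exact Finset.disjoint_left.2 fun t ht htc => hvalF t (hAF ht) (hAF (mem_compls.1 htc))
    · exact Finset.disjoint_left.2 fun t ht htc => by
        rw [mem_singleton] at ht; subst ht
        rw [mem_compls, mem_singleton] at htc
        exact compl_ne_self_of_nonempty hne hu htc
    · rw [compls_compls]
      exact Finset.disjoint_left.2 fun t htc ht => hvalF t (hF₂F ht) (hF₂F (mem_compls.1 htc))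
    · exact Finset.disjoint_left.2 fun t ht htu => by
        rw [mem_singleton] at htu; subst htu; exact hu (hAF ht)
    · exact Finset.disjoint_left.2 fun t ht htc => by
        rw [mem_singleton] at ht; subst ht; exact huc (hF₂F (mem_compls.1 htc))
    · exact Finset.disjoint_left.2 fun t htc ht => hvalF t (hAF ht) (hF₂F (mem_compls.1 htc))
    · exact Finset.disjoint_left.2 fun t ht htc => by
        rw [mem_compls, mem_singleton] at htc
        apply huc
        rw [← htc, Finset.sdiff_sdiff_eq_self (subset_univ t)]
        exact hAF ht
    · rw [compls_compls]
      exact Finset.disjoint_left.2 fun t ht htF => by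
        rw [mem_singleton] at ht; subst ht; exact hu (hF₂F htF)
    · exact Finset.disjoint_left.2 fun t htc htA => by
        have h1 := mem_compls.1 htc
        have h2 := mem_compls.1 htA
        exact hF₂σ _ h1 (hAσ _ h2)
  -- the (Θ)-difference family lies in `D`
  have h0D : (∅ : Finset α) ∈ D := by
    obtain ⟨t, ht⟩ := hne
    exact hD (mem_diffs.2 ⟨t, ht, t, ht, Finset.sdiff_self t⟩)
  have hsub : thetaD A {u} (compls F₂) ⊆ D := by
    intro x hx
    unfold thetaD at hx
    simp only [mem_union] at hx
    rcases hx with ((((((((hx | hx) | hx) | hx) | hx) | hx) | hx) | hx) | hx)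
    · exact hD (diffs_subset hAF hAF hx)
    · obtain ⟨a, ha, b, hb, rfl⟩ := mem_diffs.1 hx
      rw [mem_singleton] at ha hb; subst ha; subst hb
      rw [Finset.sdiff_self]; exact h0D
    · obtain ⟨a, ha, b, hb, rfl⟩ := mem_diffs.1 hx
      have ha' := mem_compls.1 ha; have hb' := mem_compls.1 hb
      have e : a \ b = (Finset.univ \ b) \ (Finset.univ \ a) := by
        ext y; simp only [mem_sdiff, mem_univ, true_and, not_not]; tauto
      rw [e]; exact hD (mem_diffs.2 ⟨_, hF₂F hb', _, hF₂F ha', rfl⟩)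
    · obtain ⟨a, ha, b, hb, rfl⟩ := mem_infs.1 hx
      rw [mem_singleton] at hb; subst hb
      rw [inf_eq_inter]; exact (hcellsA a ha).1
    · obtain ⟨a, ha, b, hb, rfl⟩ := mem_infs.1 hx
      rw [mem_singleton] at ha
      have hb' := mem_compls.1 hb
      have h := (hcellsC _ hb').2
      rw [Finset.sdiff_sdiff_eq_self (subset_univ u),
        Finset.sdiff_sdiff_eq_self (subset_univ b)] at h
      rw [inf_eq_inter, inter_comm, ha]; exact h
    · obtain ⟨a, ha, b, hb, rfl⟩ := mem_infs.1 hx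
      have ha' := mem_compls.1 ha
      have e : a ⊓ b = b \ (Finset.univ \ a) := by
        rw [inf_eq_inter]; ext y; simp only [mem_inter, mem_sdiff, mem_univ, true_and, not_not]; tauto
      rw [e]; exact hD (mem_diffs.2 ⟨_, hAF hb, _, hF₂F ha', rfl⟩)
    · obtain ⟨a, ha, b, hb, hab⟩ := mem_sups.1 (mem_compls.1 hx)
      rw [mem_singleton] at hb
      rw [sup_eq_union, hb] at hab
      have hx' : x = Finset.univ \ (a ∪ u) := by
        rw [hab, Finset.sdiff_sdiff_eq_self (subset_univ x)]
      have e : Finset.univ \ (a ∪ u) = (Finset.univ \ a) ∩ (Finset.univ \ u) := by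
        ext y; simp only [mem_sdiff, mem_inter, mem_union, mem_univ, true_and, not_or]
      rw [hx', e]; exact (hcellsA a ha).2
    · obtain ⟨a, ha, b, hb, hab⟩ := mem_sups.1 (mem_compls.1 hx)
      rw [mem_singleton] at ha
      have hb' := mem_compls.1 hb
      rw [sup_eq_union, ha] at hab
      have hx' : x = Finset.univ \ (u ∪ b) := by
        rw [hab, Finset.sdiff_sdiff_eq_self (subset_univ x)]
      have e : Finset.univ \ (u ∪ b) = (Finset.univ \ b) ∩ (Finset.univ \ u) := by
        ext y; simp only [mem_sdiff, mem_inter, mem_union, mem_univ, true_and, not_or]; tauto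
      rw [hx', e]; exact (hcellsC _ hb').1
    · obtain ⟨a, ha, b, hb, hab⟩ := mem_sups.1 (mem_compls.1 hx)
      have ha' := mem_compls.1 ha
      rw [sup_eq_union] at hab
      have hx' : x = Finset.univ \ (a ∪ b) := by
        rw [hab, Finset.sdiff_sdiff_eq_self (subset_univ x)]
      have e : Finset.univ \ (a ∪ b) = (Finset.univ \ a) \ b := by
        ext y; simp only [mem_sdiff, mem_union, mem_univ, true_and, not_or]
      rw [hx', e]; exact hD (mem_diffs.2 ⟨_, hF₂F ha', _, hAF hb, rfl⟩)
  have h1 := theta_card_le_of_card_le_one hvalid (by simp)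
  have h2 := card_le_card hsub
  rw [card_singleton, card_compls] at h1
  omega

section Merge

variable {r r' : α}

omit [Fintype α] in
/-- A difference of non-separating sets is non-separating. -/
theorem nonsep_sdiff {x y : Finset α} (hx : r ∈ x ↔ r' ∈ x) (hy : r ∈ y ↔ r' ∈ y) :
    r ∈ x \ y ↔ r' ∈ x \ y := by
  simp only [mem_sdiff]; tauto

omit [Fintype α] in
/-- An intersection of non-separating sets is non-separating. -/
theorem nonsep_inter {x y : Finset α} (hx : r ∈ x ↔ r' ∈ x) (hy : r ∈ y ↔ r' ∈ y) :
    r ∈ x ∩ y ↔ r' ∈ x ∩ y := by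
  simp only [mem_inter]; tauto

/-- The complement of a non-separating set is non-separating. -/
theorem nonsep_compl {x : Finset α} (hx : r ∈ x ↔ r' ∈ x) :
    r ∈ Finset.univ \ x ↔ r' ∈ Finset.univ \ x := by
  simp only [mem_sdiff, mem_univ, true_and]; tauto

omit [Fintype α] in
/-- The differences of the non-separating members are non-separating differences. -/
theorem merge_diffs_subset (F : Finset (Finset α)) :
    (F.filter fun t => r ∈ t ↔ r' ∈ t) \\ (F.filter fun t => r ∈ t ↔ r' ∈ t) ⊆
      (F \\ F).filter fun x => r ∈ x ↔ r' ∈ x := by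
  intro x hx
  obtain ⟨a, ha, b, hb, rfl⟩ := mem_diffs.1 hx
  obtain ⟨haF, har⟩ := mem_filter.1 ha
  obtain ⟨hbF, hbr⟩ := mem_filter.1 hb
  exact mem_filter.2 ⟨mem_diffs.2 ⟨a, haF, b, hbF, rfl⟩, nonsep_sdiff har hbr⟩

/-- The required cells of a non-separating near-member at a non-separating member stay among
the non-separating differences. -/
theorem merge_cells {D : Finset (Finset α)} {t v : Finset α} (ht : r ∈ t ↔ r' ∈ t)
    (hv : r ∈ v ↔ r' ∈ v) (h : Cells D t v) :
    Cells (D.filter fun x => r ∈ x ↔ r' ∈ x) t v :=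
  ⟨mem_filter.2 ⟨h.1, nonsep_inter ht hv⟩,
    mem_filter.2 ⟨h.2, nonsep_inter (nonsep_compl ht) (nonsep_compl hv)⟩⟩

/-- **The merge lemma (M2).** For a near-member instance `(F, u)` of excess 1 and two elements
`r, r'` on the same side of `u` at which the separating differences are at least as many as the
separating members, the non-separating differences are exactly one more than the non-separating
members: the merged pair `(F', u)` is again an equality instance of the one-pair theorem. -/
theorem merge_card_eq {F : Finset (Finset α)} (σ : Finset α → Bool) {u : Finset α}
    (hval : Disjoint F (compls F)) (hex : (F \\ F).card = F.card + 1) (hu : u ∉ F)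
    (huc : Finset.univ \ u ∉ F)
    (hcells : ∀ t ∈ F, Cells (F \\ F) t (if σ t = true then u else Finset.univ \ u))
    (hur : r ∈ u ↔ r' ∈ u)
    (hsep : (F.filter fun t => ¬ (r ∈ t ↔ r' ∈ t)).card ≤
      ((F \\ F).filter fun x => ¬ (r ∈ x ↔ r' ∈ x)).card)
    (hne : (F.filter fun t => r ∈ t ↔ r' ∈ t).Nonempty) :
    ((F \\ F).filter fun x => r ∈ x ↔ r' ∈ x).card =
      (F.filter fun t => r ∈ t ↔ r' ∈ t).card + 1 := by
  have hF' : (F.filter fun t => r ∈ t ↔ r' ∈ t) ⊆ F := filter_subset _ _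
  -- the lower bound: the one-pair theorem on the merged instance
  have hge := card_add_one_le_of_cells (D := (F \\ F).filter fun x => r ∈ x ↔ r' ∈ x) σ hne
    (hval.mono hF' (compls_subset_compls hF'))
    (fun h => hu (hF' h)) (fun h => huc (hF' h)) (merge_diffs_subset F) (by
      intro t ht
      obtain ⟨htF, htr⟩ := mem_filter.1 ht
      refine merge_cells htr ?_ (hcells t htF)
      by_cases hσ : σ t = true
      · rw [if_pos hσ]; exact hur
      · rw [if_neg hσ]; exact nonsep_compl hur)
  -- the upper bound: the count of separating sets
  have hD := Finset.card_filter_add_card_filter_not (s := F \\ F) (fun x => r ∈ x ↔ r' ∈ x)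
  have hFc := Finset.card_filter_add_card_filter_not (s := F) (fun t => r ∈ t ↔ r' ∈ t)
  omega

end Merge

end PercRepro.MSTight
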